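import Summits.BirchSwinnertonDyer.BirchSwinnertonDyer.Theorems.SignedLowerHalvesSmallImageLowerHalfBothSignsRttD2SeqJ3RLocalTerms
import Literature.NumberTheory.GaloisCohomology.CupProductShapiroReciprocityCore
import Literature.NumberTheory.GaloisCohomology.ArchimedeanInvariantMap
import Mathlib.NumberTheory.NumberField.InfinitePlace.TotallyRealComplex
import HarnessLib

/-!
# Route `SignedLowerHalves`, crux L `SmallImageLowerHalfBothSigns` (stmt-BirchSwinnertonDyer-23599), line `rtt_w3` v15 — E2, row J3 residual
# (`RSeq`), brick R3: TATE–POITOU RECIPROCITY ALONG A LAYER `K̄^U/K` OF A TOTALLY COMPLEX NUMBER FIELD, READ IN THE CORESTRICTION MODEL: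
# the layer pairing at a NON-SPLIT place `v` of two classes of `H¹(U, ·)` vanishes as soon as all the other layer pairings at the places of a finite
# set `T ∋ v` vanish and both classes die on the inertia groups off `T`

WIDTH seat `bsd-line-slh-p3-w3` g23 under LEAD `cruxlead-stmt-BirchSwinnertonDyer-23599` g11 (cell `bsd-ssimc`); helper `--supports stmt-BirchSwinnertonDyer-23599`.
THEOREMS ONLY; no definition, no named fact, no instance, no `sorry`. HONEST FRAMING: Tate's reciprocity law `Σ_w inv_w = 0` (PROVED in the tree for every number field:
`GaloisCohomology.sum_localInvariantMap_cupProduct_shapiroLift_eq_zero_of_resLe_inertia`, the Shapiro-model levelwise core of the RTT@2 line) read through R1/R2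
(p793621, p793956) in the currency of J3's layer pairings (`localPairingSubgroup`); the archimedean hypothesis is VACUOUS for `K` totally complex
(`eq_one_absoluteGaloisGroup_of_isComplex`). Nothing about any curve; E2, crux L, crux M, BSD remain OPEN and are proved for NO curve.

* `sum_localInvariantMap_map_cupProduct_shapiroLift_eq_zero` — `Σ_{w ∈ T} inv_w(θ_w^*(Sh_U a ∪_{ΣP} Sh_U b)) = 0` for `K` totally complex, `n = p^r`, classes `a, b ∈ H¹(U, ·)`
  dying on `U ⊓ I_𝔓` for every prime `𝔓` over every finite place `w ∉ T`.
* ★★★ **`localPairingSubgroup_eq_zero_of_reciprocity`** — THE SUM FORMULA, receptacle form at a non-split place: if moreover `v ∈ T` has ONE place of `K̄^U` above it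
  (`ē_v` onto) and `⟨θ_{U,w}^*(g · a), θ_{U,w}^*(g · b)⟩_{U_w} = 0` for all `w ∈ T ∖ {v}` and all `g ∈ Γ_K`, then `⟨θ_{U,v}^* a, θ_{U,v}^* b⟩_{U_v} = 0`.
References: [MilneADT2006] I Thm. 4.10 (b), I §6 (proof of Prop. 6.9); [NeukirchSchmidtWingberg2008] VIII §6, I §6 (1.6.4); [CasselsFrohlichANT1967] VII §11;
[SerreGaloisCohomology1997] II §6.3; [Kobayashi2003] (8.23), Thm. 7.3 i).
-/

set_option autoImplicit false
set_option linter.dupNamespace false -- D-0017: single-problem summit, the namespace repeats the problem name by design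
noncomputable section

open scoped Classical
open CategoryTheory Function NumberField IsDedekindDomain Field

namespace Summit.BirchSwinnertonDyer.BirchSwinnertonDyer.Theorems.SmallImageRttD2Seq

open Literature.NumberTheory.GaloisRepresentations Literature.NumberTheory.GaloisCohomology Literature.NumberTheory.EllipticCurves
open Literature.NumberTheory.GaloisRepresentations.DiscreteGaloisModule (mu MuCarrier)

variable (K : Type) [Field K] [NumberField K] [IsTotallyComplex K] (n : ℕ) [NeZero n] {p : ℕ} [Fact p.Prime]
  {MX MY : Type} [AddCommGroup MX] [TopologicalSpace MX] [DiscreteTopology MX] [AddCommGroup MY] [TopologicalSpace MY] [DiscreteTopology MY]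
  (ρX : ContinuousRep (absoluteGaloisGroup K) ℤ MX) (ρY : ContinuousRep (absoluteGaloisGroup K) ℤ MY)
  (P : ContPairing ρX.toTopRep ρY.toTopRep (mu K n).toTopRep)
  (U : Subgroup (absoluteGaloisGroup K)) [hUn : U.Normal] (hU : IsOpen (U : Set (absoluteGaloisGroup K))) [Fintype (absoluteGaloisGroup K ⧸ U)]
  {s : absoluteGaloisGroup K ⧸ U → absoluteGaloisGroup K} (hs : ∀ y, (s y : absoluteGaloisGroup K ⧸ U) = y)
  (hs1 : s ((1 : absoluteGaloisGroup K) : absoluteGaloisGroup K ⧸ U) = 1)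

omit hUn in
/-- **`Σ_{w ∈ T} inv_w(θ_w^*(Sh_U a ∪_{ΣP} Sh_U b)) = 0`** for `K` totally complex, `n = p^r`, and classes `a ∈ H¹(U, X)`, `b ∈ H¹(U, Y)` dying on `U ⊓ I_𝔓` for every prime `𝔓`
over every finite place `w ∉ T` (then the Shapiro lifts are unramified off `T` and pair to zero there; the archimedean terms vanish because every infinite place is
complex, `Γ_{K_w} = 1`). The tree's levelwise reciprocity core, on classes, with the localisation written as restriction along `θ_w = resGalOfEmb (closureEmb K_w)`.
[cite: MilneADT2006, Ch. I, Thm. 2.6 and Thm. 4.10(b)] [cite: NeukirchSchmidtWingberg2008, I §6 Prop. (1.6.4) and VIII §6] [cite: SerreGaloisCohomology1997, II §6.3] -/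
theorem sum_localInvariantMap_map_cupProduct_shapiroLift_eq_zero (hn : ∃ r : ℕ, n = p ^ r) (T : Finset (HeightOneSpectrum (𝓞 K)))
    (a : continuousCohomology 1 (subgroupRep ρX.toTopRep U)) (b : continuousCohomology 1 (subgroupRep ρY.toTopRep U))
    (ha : ∀ w : HeightOneSpectrum (𝓞 K), w ∉ T → ∀ 𝔓 ∈ w.primesAbove,
      resLe ρX.toTopRep (inf_le_left : U ⊓ 𝔓.inertia (absoluteGaloisGroup K) ≤ U) 1 a = 0)
    (hb : ∀ w : HeightOneSpectrum (𝓞 K), w ∉ T → ∀ 𝔓 ∈ w.primesAbove,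
      resLe ρY.toTopRep (inf_le_left : U ⊓ 𝔓.inertia (absoluteGaloisGroup K) ≤ U) 1 b = 0) :
    ∑ w ∈ T, localInvariantMap K n w
        (ContinuousCohomology.map (resGalOfEmb (closureEmb (K := K) (w.adicCompletion K)))
          (𝟙 (TopRep.res (resGalOfEmb (closureEmb (K := K) (w.adicCompletion K)) : absoluteGaloisGroup (w.adicCompletion K) →* absoluteGaloisGroup K)
            (mu K n).toTopRep)) 2
          ((P.coindFin U).cupProduct (shapiroLift ρX.toTopRep U hU hs hs1 a) (shapiroLift ρY.toTopRep U hU hs hs1 b))) = 0 := by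
  obtain ⟨ψ₁, rfl⟩ := oneCocycleClass_surjective _ a
  obtain ⟨ψ₂, rfl⟩ := oneCocycleClass_surjective _ b
  have hanti : ∀ (w : InfinitePlace K) (y₀ : absoluteGaloisGroup K ⧸ U)
      (d : absoluteGaloisGroup (Place.Completion (Sum.inl w : Place K))), d ≠ 1 →
      (s y₀)⁻¹ * absGaloisRestrict K (Place.Completion (Sum.inl w : Place K)) d * s y₀ ∈ U →
      ∀ m : MY, ρY.toTopRep.ρ ((s y₀)⁻¹ * absGaloisRestrict K (Place.Completion (Sum.inl w : Place K)) d * s y₀) m = -m →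
        ∃ m' : MY, m = ρY.toTopRep.ρ ((s y₀)⁻¹ * absGaloisRestrict K (Place.Completion (Sum.inl w : Place K)) d * s y₀) m' - m' :=
    fun w _ d hd _ _ _ => absurd (eq_one_absoluteGaloisGroup_of_isComplex (IsTotallyComplex.isComplex w) d) hd
  exact sum_localInvariantMap_cupProduct_shapiroLift_eq_zero_of_resLe_inertia K n hn ρX ρY U hU hs hs1 (P.coindFin U) T ψ₁ ψ₂ ha hb hanti

variable (v : HeightOneSpectrum (𝓞 K))
  [hcl : ∀ w : HeightOneSpectrum (𝓞 K), IsClosed (localSubgroupOfEmb U (closureEmb (K := K) (w.adicCompletion K)) : Set (absoluteGaloisGroup (w.adicCompletion K)))]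
  [hfq : ∀ w : HeightOneSpectrum (𝓞 K), Fintype (absoluteGaloisGroup (w.adicCompletion K) ⧸ localSubgroupOfEmb U (closureEmb (K := K) (w.adicCompletion K)))]

/-- ★★★ **TATE–POITOU RECIPROCITY ALONG THE LAYER `K̄^U`, receptacle form at a non-split place `v`, corestriction model.** Let `K` be totally complex, `n = p^r`,
`P : X × Y → μₙ` a continuous `Γ_K`-pairing of discrete modules, `U ⊴ Γ_K` open of finite index, `T` a finite set of finite places with `v ∈ T`, `a ∈ H¹(U, X)`,
`b ∈ H¹(U, Y)` dying on `U ⊓ I_𝔓` for all primes `𝔓` over all `w ∉ T`. If `v` has a single place of `K̄^U` above it (`ē_v : Γ_{K_v} ⧸ U_v → Γ_K ⧸ U` onto) and the layer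
pairings `⟨θ_{U,w}^*(g · a), θ_{U,w}^*(g · b)⟩_{U_w}` vanish for all `w ∈ T ∖ {v}` and all `g ∈ Γ_K` (every place of `K̄^U` above `w`), then
`⟨θ_{U,v}^* a, θ_{U,v}^* b⟩_{U_v} = 0` — `Σ_{w ∈ T} inv_w = 0`, one orbit at `v` (R2), orbit sums elsewhere (R2).
[cite: MilneADT2006, Ch. I, Thm. 4.10(b) and §6 (proof of Prop. 6.9)] [cite: NeukirchSchmidtWingberg2008, VIII §6 and I §6 Prop. (1.6.4)] [cite: Kobayashi2003, (8.23), Thm. 7.3 i)] -/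
theorem localPairingSubgroup_eq_zero_of_reciprocity (hU : IsOpen (U : Set (absoluteGaloisGroup K))) (hn : ∃ r : ℕ, n = p ^ r)
    (T : Finset (HeightOneSpectrum (𝓞 K))) (hv : v ∈ T)
    (hsurj : Function.Surjective (quotientMapOfHom U (resGalOfEmb (closureEmb (K := K) (v.adicCompletion K)))))
    (a : continuousCohomology 1 (subgroupRep ρX.toTopRep U)) (b : continuousCohomology 1 (subgroupRep ρY.toTopRep U))
    (ha : ∀ w : HeightOneSpectrum (𝓞 K), w ∉ T → ∀ 𝔓 ∈ w.primesAbove,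
      resLe ρX.toTopRep (inf_le_left : U ⊓ 𝔓.inertia (absoluteGaloisGroup K) ≤ U) 1 a = 0)
    (hb : ∀ w : HeightOneSpectrum (𝓞 K), w ∉ T → ∀ 𝔓 ∈ w.primesAbove,
      resLe ρY.toTopRep (inf_le_left : U ⊓ 𝔓.inertia (absoluteGaloisGroup K) ≤ U) 1 b = 0)
    (hT : ∀ w ∈ T, w ≠ v → ∀ g : absoluteGaloisGroup K,
      localPairingSubgroup K n w (ρX.restrict (resGalOfEmb (closureEmb (K := K) (w.adicCompletion K))))
        (ρY.restrict (resGalOfEmb (closureEmb (K := K) (w.adicCompletion K)))) (resPairingAt K n ρX ρY P w)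
        (localSubgroupOfEmb U (closureEmb (K := K) (w.adicCompletion K)))
        (ContinuousCohomology.map (comapSubtypeHom U (resGalOfEmb (closureEmb (K := K) (w.adicCompletion K))))
          (comapCoeffHom ρX.toTopRep U (resGalOfEmb (closureEmb (K := K) (w.adicCompletion K)))) 1 (conjMap ρX.toTopRep U g 1 a))
        (ContinuousCohomology.map (comapSubtypeHom U (resGalOfEmb (closureEmb (K := K) (w.adicCompletion K))))
          (comapCoeffHom ρY.toTopRep U (resGalOfEmb (closureEmb (K := K) (w.adicCompletion K)))) 1 (conjMap ρY.toTopRep U g 1 b)) = 0) :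
    localPairingSubgroup K n v (ρX.restrict (resGalOfEmb (closureEmb (K := K) (v.adicCompletion K))))
        (ρY.restrict (resGalOfEmb (closureEmb (K := K) (v.adicCompletion K)))) (resPairingAt K n ρX ρY P v)
        (localSubgroupOfEmb U (closureEmb (K := K) (v.adicCompletion K)))
        (ContinuousCohomology.map (comapSubtypeHom U (resGalOfEmb (closureEmb (K := K) (v.adicCompletion K))))
          (comapCoeffHom ρX.toTopRep U (resGalOfEmb (closureEmb (K := K) (v.adicCompletion K)))) 1 a)
        (ContinuousCohomology.map (comapSubtypeHom U (resGalOfEmb (closureEmb (K := K) (v.adicCompletion K))))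
          (comapCoeffHom ρY.toTopRep U (resGalOfEmb (closureEmb (K := K) (v.adicCompletion K)))) 1 b) = 0 := by
  haveI : ∀ w : HeightOneSpectrum (𝓞 K), CompactSpace (absoluteGaloisGroup (w.adicCompletion K)) := fun w => absoluteGaloisGroup_compactSpace _
  haveI : CompactSpace (absoluteGaloisGroup K) := absoluteGaloisGroup_compactSpace _
  obtain ⟨s, hs, hs1⟩ := exists_reps_one U
  have hsum := sum_localInvariantMap_map_cupProduct_shapiroLift_eq_zero K n ρX ρY P U hU hs hs1 hn T a b ha hb
  rw [← Finset.add_sum_erase T _ hv, Finset.sum_eq_zero (s := T.erase v), add_zero,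
    localInvariantMap_map_cupProduct_shapiroLift_eq_of_surjective K n ρX ρY P U hU hs hs1 v hsurj a b] at hsum
  · exact hsum
  · intro w hw
    obtain ⟨hwv, hwT⟩ := Finset.mem_erase.mp hw
    exact localInvariantMap_map_cupProduct_shapiroLift_eq_zero_of_forall_conj K n ρX ρY P U hU hs hs1 w a b (hT w hwT hwv)

end Summit.BirchSwinnertonDyer.BirchSwinnertonDyer.Theorems.SmallImageRttD2Seq

end
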